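import Mathlib.RingTheory.PowerSeries.Inverse
import Mathlib.RingTheory.PowerSeries.NoZeroDivisors
import Mathlib.RingTheory.LocalRing.ResidueField.Basic
import Mathlib.NumberTheory.Padics.Complex
import Literature.NumberTheory.EllipticCurves.YanZhu2026.GreenbergMainTheorems
import Summits.BirchSwinnertonDyer.BirchSwinnertonDyer.Theorems.EisensteinDepletionAtTwoStarOptBNSFKummerAlg
import HarnessLib

/-!
# ACPIN-NEC — the necessary condition forced by fibre pinning at a datum with `G(0,0) ∈ 𝔪`
# (audit-2 ADDENDUM-5 §A5.2 algebra, kernel form; O2 `BDPSelmerLowerDivisibilityAtTwo`, stmt-BirchSwinnertonDyer-24728)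

Helper file `--supports stmt-BirchSwinnertonDyer-24728` (LEAD `cruxlead-stmt-BirchSwinnertonDyer-19556` g15, executing the pen's
SUMMON «ACPIN-NEC», key (k1)).  THEOREMS ONLY (no definition, no named fact, no instance, no `sorry`); standard axioms.

The registered research stub ACPIN `stub_acFibrePinning` of the O2 line of record `two_variable_gv_squeeze_two` (v9,
sha16 080a657270cd3519) asserts, at every admissible datum, `FibrePinned G (toUnr₂ 2 J C₀)`:
SOME prime `𝔓` of the special fibre `Ω = 𝔽̄₂⟦T₁⟧⟦T₂⟧` with (N) `red G ∉ 𝔓` and (Λ) for every primitive part `C₁` of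
`toUnr₂ 2 J C₀ = 2^a · C₁` (`red C₁ ≠ 0`): `red C₁ ∈ 𝔓 ⊔ (red G)`.  The instrument reading W⁺ of audit-2 ADDENDUM-5
(`HOME/audit/D-AUDIT-O2-NORM-dprime-ADDENDUM-5.md` @1049a3e3c6ced77e, eng-2 RS-DIAGONAL v1) is «`G(0,0) = 4·unit`», in
particular `G(0,0) ∈ 𝔪_{𝒪_{ℂ₂}}`, i.e. `red G` has ZERO constant term.  The algebra of §A5.2, proved here:

* §1 (Mathlib only, any local coefficient ring `S`, `Ω = S⟦T₁⟧⟦T₂⟧`): `φ ∈ 𝔪_Ω ↔ φ(0,0) ∈ 𝔪_S`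
  (`mem_maximalIdeal_iff_constantCoeff_constantCoeff_mem`); ★ `constantCoeff_constantCoeff_mem_maximalIdeal_of_mem_sup_span`:
  if `g(0,0) ∈ 𝔪_S`, `𝔓 ≠ ⊤` and `c ∈ 𝔓 ⊔ (g)` then `c(0,0) ∈ 𝔪_S` — because EVERY proper ideal of the local ring `Ω` lies in
  `𝔪_Ω` and so does `(g)`; field form `…_eq_zero_of_mem_sup_span` (`g(0,0) = 0 ⇒ c(0,0) = 0`).
* §2 reduction bookkeeping (`red = map (map residue)`): `(red φ)(0,0) = residue (φ(0,0))`, so `(red φ)(0,0) = 0 ↔ φ(0,0) ∈ 𝔪`.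
* §3 ★ `constantCoeff_constantCoeff_mem_maximalIdeal_of_residual_pin` (any local `R`, `A = R⟦T₁⟧⟦T₂⟧`): `G(0,0) ∈ 𝔪_R`,
  `𝔓 ≠ ⊤` in the special fibre and `red C₁ ∈ 𝔓 ⊔ (red G)` ⟹ `C₁(0,0) ∈ 𝔪_R`; hence `C₁` is NOT a unit of `A`
  (`not_isUnit_of_residual_pin`).
* §4 the `FibrePinned`-shaped statements over `𝒪_{ℂ_p}⟦T₁⟧⟦T₂⟧` (the line's `A₂`, `Ω₂`, `red₂` UNFOLDED, hypothesis = the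
  line's `FibrePinned G C'` unfolded verbatim; general prime with `(p : ℕ)`-content and the `p = 2` literal form):
  ★ `constantCoeff_constantCoeff_mem_maximalIdeal_of_fibrePinned[_two]` — every primitive part `C₁` of `C'` has
  `C₁(0,0) ∈ 𝔪_{𝒪_{ℂ_p}}`; `not_isUnit_of_fibrePinned[_two]` — `C'` is never `p^a · unit`.
* §5 back on `Λ_K = ℤ_p⟦T₁⟧⟦T₂⟧` along `toUnr₂ p J`: ★ `span_singleton_ne_span_natCast_pow_of_fibrePinned` /
  `span_singleton_ne_span_two_pow_of_fibrePinned` — if `FibrePinned G (toUnr₂ p J C₀)` and `G(0,0) ∈ 𝔪` then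
  `(C₀) ≠ (p^μ)` for every `μ`: the characteristic ideal is not pure-`μ` (its `μ`-free part is a NON-UNIT of `Λ_K`).

HONEST SCOPE.  The hypothesis «`G(0,0) ∈ 𝔪`» is the W⁺ READING of the typed Greenberg object of O2 at three data
((1289a1 | 1913b1 | 113a1), `K = ℚ(√−7)`) — an instrument fact about O2's `G` IF O2 holds there, not a theorem of the tree.
What is proved is the IMPLICATION «fibre pinning ∧ `G(0,0) ∈ 𝔪` ⟹ `ch ≠ (p^μ)`», a necessary condition on the algebraic
side and a refutation handle (a proof of `ch(X_Gr₂) = (2^μ)` at a W⁺ datum kills ACPIN there).  It decides nothing about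
N_ac / Λ_ac, closes no stub, and proves nothing about any elliptic curve; O2 (24728), 19556, 19218 stay OPEN; BSD is
proved for no curve.  References: [folklore] (local rings; units of power-series rings); audit-2 ADDENDUM-5 §A5.2; pen SUMMON
@eb3ad7df8820a5a1; the line's §ACPIN (`Cruxes/OrdLambdaHalfAtTwo/Lines/kato_determinant_greenberg_two_O2_gv_squeeze_v4.lean`).
-/

-- D-0017: single-problem summit, the namespace repeats the problem name by design.
set_option linter.dupNamespace false
set_option autoImplicit false

noncomputable section

open scoped Classical

namespace Summit.BirchSwinnertonDyer.BirchSwinnertonDyer.Theorems.TwoAdicBDPAcPinNecessary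

open PowerSeries Literature.NumberTheory.EllipticCurves

/-! ## §1 Two-variable power series over a local ring: the maximal ideal is read on the constant term -/

/-- `(map (map f) φ)(0,0) = f (φ(0,0))` (two variables; the one-variable step is the tree's
`DepletionAtTwo.KummerAlg.constantCoeff_map'`). [folklore] -/
theorem constantCoeff_constantCoeff_map_map {R S : Type*} [CommRing R] [CommRing S] (f : R →+* S)
    (φ : PowerSeries (PowerSeries R)) :
    constantCoeff (constantCoeff (PowerSeries.map (PowerSeries.map f) φ)) = f (constantCoeff (constantCoeff φ)) := by
  rw [Summit.BirchSwinnertonDyer.BirchSwinnertonDyer.Theorems.DepletionAtTwo.KummerAlg.constantCoeff_map',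
    Summit.BirchSwinnertonDyer.BirchSwinnertonDyer.Theorems.DepletionAtTwo.KummerAlg.constantCoeff_map']

/-- Over a local ring `S`: `φ ∈ 𝔪_{S⟦T⟧} ↔ φ(0) ∈ 𝔪_S` (a power series is a unit iff its constant term is). [folklore] -/
theorem mem_maximalIdeal_iff_constantCoeff_mem {S : Type*} [CommRing S] [IsLocalRing S] (φ : PowerSeries S) :
    φ ∈ IsLocalRing.maximalIdeal (PowerSeries S) ↔ constantCoeff φ ∈ IsLocalRing.maximalIdeal S := by
  rw [IsLocalRing.mem_maximalIdeal, IsLocalRing.mem_maximalIdeal, mem_nonunits_iff, mem_nonunits_iff,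
    PowerSeries.isUnit_iff_constantCoeff]

/-- Over a local ring `S`: `φ ∈ 𝔪_{S⟦T₁⟧⟦T₂⟧} ↔ φ(0,0) ∈ 𝔪_S`. [folklore] -/
theorem mem_maximalIdeal_iff_constantCoeff_constantCoeff_mem {S : Type*} [CommRing S] [IsLocalRing S]
    (φ : PowerSeries (PowerSeries S)) :
    φ ∈ IsLocalRing.maximalIdeal (PowerSeries (PowerSeries S)) ↔
      constantCoeff (constantCoeff φ) ∈ IsLocalRing.maximalIdeal S := by
  rw [mem_maximalIdeal_iff_constantCoeff_mem, mem_maximalIdeal_iff_constantCoeff_mem]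

/-- **The abstract lemma (local-ring form).**  In `Ω = S⟦T₁⟧⟦T₂⟧` over a local ring `S`: if `g(0,0) ∈ 𝔪_S`, `𝔓` is a
PROPER ideal of `Ω` and `c ∈ 𝔓 ⊔ (g)`, then `c(0,0) ∈ 𝔪_S` — every proper ideal of the local ring `Ω` lies in `𝔪_Ω`,
and so does `(g)`. [folklore] -/
theorem constantCoeff_constantCoeff_mem_maximalIdeal_of_mem_sup_span {S : Type*} [CommRing S] [IsLocalRing S]
    {g c : PowerSeries (PowerSeries S)} {𝔓 : Ideal (PowerSeries (PowerSeries S))} (h𝔓 : 𝔓 ≠ ⊤)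
    (hg : constantCoeff (constantCoeff g) ∈ IsLocalRing.maximalIdeal S) (hc : c ∈ 𝔓 ⊔ Ideal.span {g}) :
    constantCoeff (constantCoeff c) ∈ IsLocalRing.maximalIdeal S := by
  rw [← mem_maximalIdeal_iff_constantCoeff_constantCoeff_mem] at hg ⊢
  exact sup_le (IsLocalRing.le_maximalIdeal h𝔓) ((Ideal.span_singleton_le_iff_mem _).mpr hg) hc

/-- **The abstract lemma (field form, as in audit-2 ADDENDUM-5 §A5.2).**  In `Ω = k⟦T₁⟧⟦T₂⟧` over a field `k`: if
`g(0,0) = 0`, `𝔓` is a proper ideal and `c ∈ 𝔓 ⊔ (g)`, then `c(0,0) = 0`. [folklore] -/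
theorem constantCoeff_constantCoeff_eq_zero_of_mem_sup_span {k : Type*} [Field k]
    {g c : PowerSeries (PowerSeries k)} {𝔓 : Ideal (PowerSeries (PowerSeries k))} (h𝔓 : 𝔓 ≠ ⊤)
    (hg : constantCoeff (constantCoeff g) = 0) (hc : c ∈ 𝔓 ⊔ Ideal.span {g}) :
    constantCoeff (constantCoeff c) = 0 := by
  have h := constantCoeff_constantCoeff_mem_maximalIdeal_of_mem_sup_span h𝔓
    (by rw [hg]; exact Ideal.zero_mem _) hc
  rwa [IsLocalRing.maximalIdeal_eq_bot, Ideal.mem_bot] at h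

/-- The same with a PRIME `𝔓` (the shape of the line's `FibrePinned`). [folklore] -/
theorem constantCoeff_constantCoeff_eq_zero_of_mem_sup_span_of_isPrime {k : Type*} [Field k]
    {g c : PowerSeries (PowerSeries k)} {𝔓 : Ideal (PowerSeries (PowerSeries k))} (h𝔓 : 𝔓.IsPrime)
    (hg : constantCoeff (constantCoeff g) = 0) (hc : c ∈ 𝔓 ⊔ Ideal.span {g}) :
    constantCoeff (constantCoeff c) = 0 :=
  constantCoeff_constantCoeff_eq_zero_of_mem_sup_span h𝔓.ne_top hg hc

/-! ## §2 Reduction to the special fibre: `(red φ)(0,0) = residue (φ(0,0))` -/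

/-- `(red φ)(0,0) = residue (φ(0,0))` for `red = map (map residue)`. [folklore] -/
theorem constantCoeff_constantCoeff_map_map_residue {R : Type*} [CommRing R] [IsLocalRing R]
    (φ : PowerSeries (PowerSeries R)) :
    constantCoeff (constantCoeff (PowerSeries.map (PowerSeries.map (IsLocalRing.residue R)) φ)) =
      IsLocalRing.residue R (constantCoeff (constantCoeff φ)) :=
  constantCoeff_constantCoeff_map_map _ φ

/-- `(red φ)(0,0) = 0 ↔ φ(0,0) ∈ 𝔪_R`. [folklore] -/
theorem constantCoeff_constantCoeff_map_map_residue_eq_zero_iff {R : Type*} [CommRing R] [IsLocalRing R]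
    (φ : PowerSeries (PowerSeries R)) :
    constantCoeff (constantCoeff (PowerSeries.map (PowerSeries.map (IsLocalRing.residue R)) φ)) = 0 ↔
      constantCoeff (constantCoeff φ) ∈ IsLocalRing.maximalIdeal R := by
  rw [constantCoeff_constantCoeff_map_map_residue, IsLocalRing.residue_eq_zero_iff]

/-! ## §3 The pin consequence over any local coefficient ring -/

/-- ★ **Residual pin ⟹ non-unit constant term.**  `A = R⟦T₁⟧⟦T₂⟧` over a local ring `R`, special fibre
`Ω = (R/𝔪)⟦T₁⟧⟦T₂⟧`, `red = map (map residue)`: if `G(0,0) ∈ 𝔪_R`, `𝔓 ≠ ⊤` in `Ω` and `red C₁ ∈ 𝔓 ⊔ (red G)`, then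
`C₁(0,0) ∈ 𝔪_R`. [folklore] -/
theorem constantCoeff_constantCoeff_mem_maximalIdeal_of_residual_pin {R : Type*} [CommRing R] [IsLocalRing R]
    {G C₁ : PowerSeries (PowerSeries R)}
    {𝔓 : Ideal (PowerSeries (PowerSeries (IsLocalRing.ResidueField R)))} (h𝔓 : 𝔓 ≠ ⊤)
    (hG0 : constantCoeff (constantCoeff G) ∈ IsLocalRing.maximalIdeal R)
    (hΛ : PowerSeries.map (PowerSeries.map (IsLocalRing.residue R)) C₁ ∈
      𝔓 ⊔ Ideal.span {PowerSeries.map (PowerSeries.map (IsLocalRing.residue R)) G}) :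
    constantCoeff (constantCoeff C₁) ∈ IsLocalRing.maximalIdeal R := by
  rw [← constantCoeff_constantCoeff_map_map_residue_eq_zero_iff] at hG0 ⊢
  exact constantCoeff_constantCoeff_eq_zero_of_mem_sup_span h𝔓 hG0 hΛ

/-- … hence `C₁` is NOT a unit of `A = R⟦T₁⟧⟦T₂⟧`. [folklore] -/
theorem not_isUnit_of_residual_pin {R : Type*} [CommRing R] [IsLocalRing R]
    {G C₁ : PowerSeries (PowerSeries R)}
    {𝔓 : Ideal (PowerSeries (PowerSeries (IsLocalRing.ResidueField R)))} (h𝔓 : 𝔓 ≠ ⊤)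
    (hG0 : constantCoeff (constantCoeff G) ∈ IsLocalRing.maximalIdeal R)
    (hΛ : PowerSeries.map (PowerSeries.map (IsLocalRing.residue R)) C₁ ∈
      𝔓 ⊔ Ideal.span {PowerSeries.map (PowerSeries.map (IsLocalRing.residue R)) G}) :
    ¬ IsUnit C₁ := by
  intro hu
  have h := constantCoeff_constantCoeff_mem_maximalIdeal_of_residual_pin h𝔓 hG0 hΛ
  exact (mem_nonunits_iff.mp ((IsLocalRing.mem_maximalIdeal _).mp h)) ((hu.map _).map _)

/-! ## §4 The `FibrePinned`-shaped statements over `𝒪_{ℂ_p}⟦T₁⟧⟦T₂⟧` (the line's `A₂`, `Ω₂`, `red₂` unfolded) -/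

section PadicComplex

variable {p : ℕ} [Fact p.Prime]

/-- ★ **ACPIN-NEC, primitive-part form (general prime).**  Hypothesis `hpin` is the line's `FibrePinned G C'` UNFOLDED
(content read with `(p : ℕ)`): if moreover `G(0,0) ∈ 𝔪_{𝒪_{ℂ_p}}` (the W⁺ reading «`red G` has zero constant term»), then
EVERY primitive part `C₁` of `C'` (`C' = p^a · C₁`, `red C₁ ≠ 0`) has `C₁(0,0) ∈ 𝔪_{𝒪_{ℂ_p}}`.  Only clause (Λ) and
`𝔓 ≠ ⊤` are used. [folklore] -/
theorem constantCoeff_constantCoeff_mem_maximalIdeal_of_fibrePinned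
    (G C' : PowerSeries (PowerSeries (PadicComplexInt p)))
    (hpin : ∃ 𝔓 : Ideal (PowerSeries (PowerSeries (IsLocalRing.ResidueField (PadicComplexInt p)))),
      𝔓.IsPrime ∧ PowerSeries.map (PowerSeries.map (IsLocalRing.residue (PadicComplexInt p))) G ∉ 𝔓 ∧
      ∀ (a : ℕ) (C₁ : PowerSeries (PowerSeries (PadicComplexInt p))),
        C' = ((p : ℕ) : PowerSeries (PowerSeries (PadicComplexInt p))) ^ a * C₁ →
        PowerSeries.map (PowerSeries.map (IsLocalRing.residue (PadicComplexInt p))) C₁ ≠ 0 →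
        PowerSeries.map (PowerSeries.map (IsLocalRing.residue (PadicComplexInt p))) C₁ ∈
          𝔓 ⊔ Ideal.span {PowerSeries.map (PowerSeries.map (IsLocalRing.residue (PadicComplexInt p))) G})
    (hG0 : constantCoeff (constantCoeff G) ∈ IsLocalRing.maximalIdeal (PadicComplexInt p))
    (a : ℕ) (C₁ : PowerSeries (PowerSeries (PadicComplexInt p)))
    (hC' : C' = ((p : ℕ) : PowerSeries (PowerSeries (PadicComplexInt p))) ^ a * C₁)
    (hC₁ : PowerSeries.map (PowerSeries.map (IsLocalRing.residue (PadicComplexInt p))) C₁ ≠ 0) :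
    constantCoeff (constantCoeff C₁) ∈ IsLocalRing.maximalIdeal (PadicComplexInt p) := by
  obtain ⟨𝔓, h𝔓, -, hΛ⟩ := hpin
  exact constantCoeff_constantCoeff_mem_maximalIdeal_of_residual_pin h𝔓.ne_top hG0 (hΛ a C₁ hC' hC₁)

/-- **ACPIN-NEC, unit form (general prime).**  Under the line's `FibrePinned G C'` (unfolded) and `G(0,0) ∈ 𝔪`:
`C'` is never `p^a · u` with `u` a unit of `𝒪_{ℂ_p}⟦T₁⟧⟦T₂⟧`. [folklore] -/
theorem not_isUnit_of_fibrePinned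
    (G C' : PowerSeries (PowerSeries (PadicComplexInt p)))
    (hpin : ∃ 𝔓 : Ideal (PowerSeries (PowerSeries (IsLocalRing.ResidueField (PadicComplexInt p)))),
      𝔓.IsPrime ∧ PowerSeries.map (PowerSeries.map (IsLocalRing.residue (PadicComplexInt p))) G ∉ 𝔓 ∧
      ∀ (a : ℕ) (C₁ : PowerSeries (PowerSeries (PadicComplexInt p))),
        C' = ((p : ℕ) : PowerSeries (PowerSeries (PadicComplexInt p))) ^ a * C₁ →
        PowerSeries.map (PowerSeries.map (IsLocalRing.residue (PadicComplexInt p))) C₁ ≠ 0 →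
        PowerSeries.map (PowerSeries.map (IsLocalRing.residue (PadicComplexInt p))) C₁ ∈
          𝔓 ⊔ Ideal.span {PowerSeries.map (PowerSeries.map (IsLocalRing.residue (PadicComplexInt p))) G})
    (hG0 : constantCoeff (constantCoeff G) ∈ IsLocalRing.maximalIdeal (PadicComplexInt p))
    (a : ℕ) (u : PowerSeries (PowerSeries (PadicComplexInt p)))
    (hC' : C' = ((p : ℕ) : PowerSeries (PowerSeries (PadicComplexInt p))) ^ a * u) :
    ¬ IsUnit u := by
  intro hu
  have hne : PowerSeries.map (PowerSeries.map (IsLocalRing.residue (PadicComplexInt p))) u ≠ 0 :=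
    (hu.map _).ne_zero
  have h := constantCoeff_constantCoeff_mem_maximalIdeal_of_fibrePinned G C' hpin hG0 a u hC' hne
  exact (mem_nonunits_iff.mp ((IsLocalRing.mem_maximalIdeal _).mp h)) ((hu.map _).map _)

/-- ★ **ACPIN-NEC, primitive-part form, `p = 2` literal** (content `(2 : A₂) ^ a`, exactly the line's `FibrePinned`).
[folklore] -/
theorem constantCoeff_constantCoeff_mem_maximalIdeal_of_fibrePinned_two
    (G C' : PowerSeries (PowerSeries (PadicComplexInt 2)))
    (hpin : ∃ 𝔓 : Ideal (PowerSeries (PowerSeries (IsLocalRing.ResidueField (PadicComplexInt 2)))),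
      𝔓.IsPrime ∧ PowerSeries.map (PowerSeries.map (IsLocalRing.residue (PadicComplexInt 2))) G ∉ 𝔓 ∧
      ∀ (a : ℕ) (C₁ : PowerSeries (PowerSeries (PadicComplexInt 2))),
        C' = (2 : PowerSeries (PowerSeries (PadicComplexInt 2))) ^ a * C₁ →
        PowerSeries.map (PowerSeries.map (IsLocalRing.residue (PadicComplexInt 2))) C₁ ≠ 0 →
        PowerSeries.map (PowerSeries.map (IsLocalRing.residue (PadicComplexInt 2))) C₁ ∈
          𝔓 ⊔ Ideal.span {PowerSeries.map (PowerSeries.map (IsLocalRing.residue (PadicComplexInt 2))) G})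
    (hG0 : constantCoeff (constantCoeff G) ∈ IsLocalRing.maximalIdeal (PadicComplexInt 2))
    (a : ℕ) (C₁ : PowerSeries (PowerSeries (PadicComplexInt 2)))
    (hC' : C' = (2 : PowerSeries (PowerSeries (PadicComplexInt 2))) ^ a * C₁)
    (hC₁ : PowerSeries.map (PowerSeries.map (IsLocalRing.residue (PadicComplexInt 2))) C₁ ≠ 0) :
    constantCoeff (constantCoeff C₁) ∈ IsLocalRing.maximalIdeal (PadicComplexInt 2) := by
  obtain ⟨𝔓, h𝔓, -, hΛ⟩ := hpin
  exact constantCoeff_constantCoeff_mem_maximalIdeal_of_residual_pin h𝔓.ne_top hG0 (hΛ a C₁ hC' hC₁)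

/-- **ACPIN-NEC, unit form, `p = 2` literal**: `C'` is never `2^a · u` with `u` a unit. [folklore] -/
theorem not_isUnit_of_fibrePinned_two
    (G C' : PowerSeries (PowerSeries (PadicComplexInt 2)))
    (hpin : ∃ 𝔓 : Ideal (PowerSeries (PowerSeries (IsLocalRing.ResidueField (PadicComplexInt 2)))),
      𝔓.IsPrime ∧ PowerSeries.map (PowerSeries.map (IsLocalRing.residue (PadicComplexInt 2))) G ∉ 𝔓 ∧
      ∀ (a : ℕ) (C₁ : PowerSeries (PowerSeries (PadicComplexInt 2))),
        C' = (2 : PowerSeries (PowerSeries (PadicComplexInt 2))) ^ a * C₁ →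
        PowerSeries.map (PowerSeries.map (IsLocalRing.residue (PadicComplexInt 2))) C₁ ≠ 0 →
        PowerSeries.map (PowerSeries.map (IsLocalRing.residue (PadicComplexInt 2))) C₁ ∈
          𝔓 ⊔ Ideal.span {PowerSeries.map (PowerSeries.map (IsLocalRing.residue (PadicComplexInt 2))) G})
    (hG0 : constantCoeff (constantCoeff G) ∈ IsLocalRing.maximalIdeal (PadicComplexInt 2))
    (a : ℕ) (u : PowerSeries (PowerSeries (PadicComplexInt 2)))
    (hC' : C' = (2 : PowerSeries (PowerSeries (PadicComplexInt 2))) ^ a * u) :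
    ¬ IsUnit u := by
  intro hu
  have hne : PowerSeries.map (PowerSeries.map (IsLocalRing.residue (PadicComplexInt 2))) u ≠ 0 :=
    (hu.map _).ne_zero
  have h := constantCoeff_constantCoeff_mem_maximalIdeal_of_fibrePinned_two G C' hpin hG0 a u hC' hne
  exact (mem_nonunits_iff.mp ((IsLocalRing.mem_maximalIdeal _).mp h)) ((hu.map _).map _)

/-! ## §5 Back on `Λ_K = ℤ_p⟦T₁⟧⟦T₂⟧`: the characteristic ideal is not pure-`μ` -/

/-- ★ **ACPIN-NEC on `Λ_K` (general prime).**  If `FibrePinned G (toUnr₂ p J C₀)` (unfolded, `(p : ℕ)`-content) and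
`G(0,0) ∈ 𝔪_{𝒪_{ℂ_p}}`, then `(C₀) ≠ (p^μ)` in `Λ_K` for every `μ`: the `μ`-free part of `C₀` is a non-unit. [folklore] -/
theorem span_singleton_ne_span_natCast_pow_of_fibrePinned (J : ℤ_[p] →+* PadicComplexInt p)
    (C₀ : IwasawaAlgebra₂ p) (G : PowerSeries (PowerSeries (PadicComplexInt p)))
    (hpin : ∃ 𝔓 : Ideal (PowerSeries (PowerSeries (IsLocalRing.ResidueField (PadicComplexInt p)))),
      𝔓.IsPrime ∧ PowerSeries.map (PowerSeries.map (IsLocalRing.residue (PadicComplexInt p))) G ∉ 𝔓 ∧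
      ∀ (a : ℕ) (C₁ : PowerSeries (PowerSeries (PadicComplexInt p))),
        IwasawaAlgebra₂.toUnr₂ p J C₀ = ((p : ℕ) : PowerSeries (PowerSeries (PadicComplexInt p))) ^ a * C₁ →
        PowerSeries.map (PowerSeries.map (IsLocalRing.residue (PadicComplexInt p))) C₁ ≠ 0 →
        PowerSeries.map (PowerSeries.map (IsLocalRing.residue (PadicComplexInt p))) C₁ ∈
          𝔓 ⊔ Ideal.span {PowerSeries.map (PowerSeries.map (IsLocalRing.residue (PadicComplexInt p))) G})
    (hG0 : constantCoeff (constantCoeff G) ∈ IsLocalRing.maximalIdeal (PadicComplexInt p)) (μ : ℕ) :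
    Ideal.span {C₀} ≠ Ideal.span {((p : ℕ) : IwasawaAlgebra₂ p) ^ μ} := by
  intro h
  obtain ⟨u, hu⟩ := (Ideal.span_singleton_eq_span_singleton.mp h).symm
  have hC' : IwasawaAlgebra₂.toUnr₂ p J C₀ =
      ((p : ℕ) : PowerSeries (PowerSeries (PadicComplexInt p))) ^ μ *
        IwasawaAlgebra₂.toUnr₂ p J (u : IwasawaAlgebra₂ p) := by
    rw [← hu, map_mul, map_pow, map_natCast]
  exact not_isUnit_of_fibrePinned G _ hpin hG0 μ _ hC' (u.isUnit.map _)

/-- ★ **ACPIN-NEC on `Λ_K`, `p = 2` literal** (content `(2 : A₂) ^ a` exactly as in the line's `FibrePinned`; conclusion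
`(C₀) ≠ (2^μ)` in `ℤ₂⟦T₁⟧⟦T₂⟧`).  With `ch_{Λ_K}(X_Gr₂) = (C₀)` this reads: at a W⁺ datum, ACPIN forces `ch(X_Gr₂) ≠ (2^μ)`
for every `μ` — `X_Gr₂` is not pseudo-pure-`μ` (nor pseudo-null). [folklore] -/
theorem span_singleton_ne_span_two_pow_of_fibrePinned (J : ℤ_[2] →+* PadicComplexInt 2)
    (C₀ : IwasawaAlgebra₂ 2) (G : PowerSeries (PowerSeries (PadicComplexInt 2)))
    (hpin : ∃ 𝔓 : Ideal (PowerSeries (PowerSeries (IsLocalRing.ResidueField (PadicComplexInt 2)))),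
      𝔓.IsPrime ∧ PowerSeries.map (PowerSeries.map (IsLocalRing.residue (PadicComplexInt 2))) G ∉ 𝔓 ∧
      ∀ (a : ℕ) (C₁ : PowerSeries (PowerSeries (PadicComplexInt 2))),
        IwasawaAlgebra₂.toUnr₂ 2 J C₀ = (2 : PowerSeries (PowerSeries (PadicComplexInt 2))) ^ a * C₁ →
        PowerSeries.map (PowerSeries.map (IsLocalRing.residue (PadicComplexInt 2))) C₁ ≠ 0 →
        PowerSeries.map (PowerSeries.map (IsLocalRing.residue (PadicComplexInt 2))) C₁ ∈
          𝔓 ⊔ Ideal.span {PowerSeries.map (PowerSeries.map (IsLocalRing.residue (PadicComplexInt 2))) G})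
    (hG0 : constantCoeff (constantCoeff G) ∈ IsLocalRing.maximalIdeal (PadicComplexInt 2)) (μ : ℕ) :
    Ideal.span {C₀} ≠ Ideal.span {(2 : IwasawaAlgebra₂ 2) ^ μ} := by
  intro h
  obtain ⟨u, hu⟩ := (Ideal.span_singleton_eq_span_singleton.mp h).symm
  have hC' : IwasawaAlgebra₂.toUnr₂ 2 J C₀ =
      (2 : PowerSeries (PowerSeries (PadicComplexInt 2))) ^ μ *
        IwasawaAlgebra₂.toUnr₂ 2 J (u : IwasawaAlgebra₂ 2) := by
    rw [← hu, map_mul, map_pow, map_ofNat]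
  exact not_isUnit_of_fibrePinned_two G _ hpin hG0 μ _ hC' (u.isUnit.map _)

end PadicComplex

end Summit.BirchSwinnertonDyer.BirchSwinnertonDyer.Theorems.TwoAdicBDPAcPinNecessary

end
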